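import Mathlib
import Literature.Probability.PointProcesses.LensConsistentLaw
import Literature.MathematicalPhysics.StatisticalMechanics.LennardJonesClusters
import Summits.AtomisticToContinuum.Crystallization.Theorems.FrustrationRangeCertificatesPatternPricedCertificatesStubAbstractMeanDuality
import HarnessLib

/-!
# Crux `PatternPricedCertificates` (stmt-AtomisticToContinuum-12974), line `registered` — stub `stub_meanDuality`

**Strong LP duality at finite level for means.** Let `Ω` be the `(δ, L)`-admissible rooted
patterns (`IsRootedPattern δ L S`) of `ℝ³` and, for a rule `g (v, p, q)`, let
`T_g(S) = Σ_{v ∈ lens r L S} [g(v, B_r S, B_r(reroot S v)) − g(−v, B_r(reroot S v), B_r S)]` be the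
level-`(r, L)` mass transport.  A *mean* is a linear functional `m` on all functions
`Finset ℝ³ → ℝ`, nonnegative on functions valued in `[0, 1]` on `Ω`, with `m 1 = 1`; it is
*lens-consistent* if `m (T_g) = 0` for every bounded `g`.  If every lens-consistent mean is `≥ 0`
at a functional `a` bounded on `Ω`, then for every `η > 0` some bounded rule `g` achieves
`a + T_g ≥ −η` pointwise on `Ω`.

**Proof.** Specialise the abstract LP duality for means `stub_abstractMeanDuality` (algebraic
Hahn–Banach on the space of `Ω`-bounded functions, landed sibling module
`…StubAbstractMeanDuality`) to `Ω` and the cone `K = {T_g | g bounded}`: `K` is closed under `+`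
and scaling and contains `0` (`T` is linear in `g`), its elements are bounded on `Ω`
(`|T_g S| ≤ 2 M · #S` and the packing bound `card_le_of_separated_of_dist_le`,
`meanDuality_card_le`), and none is uniformly negative on `Ω` (the vacuum pattern `∅ ∈ Ω` has
`T_g ∅ = 0`).  The resulting mean is lens-consistent, so the hypothesis gives `m a ≥ 0`, while
`m a ≤ sup_g inf_Ω (a + T_g)`; if no bounded `g` achieved `a + T_g ≥ −η` on `Ω` we would get
`m a ≤ −η < 0`.  No new definitions; nothing is assumed. [folklore]
-/

noncomputable section

open scoped BigOperators Classical

namespace Summit.AtomisticToContinuum.Crystallization.Theorems.PatternPricedCertificates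

open Literature.Probability.PointProcesses (IsRootedPattern ballPattern lens reroot)

/-- **Packing bound for admissible patterns**: a `(δ, L)`-admissible rooted pattern of `ℝ³` has
at most `(2 max(L,0)/δ + 1)³` points. [folklore] -/
theorem meanDuality_card_le {δ L : ℝ} (hδ : 0 < δ) {S : Finset (EuclideanSpace ℝ (Fin 3))}
    (hS : IsRootedPattern δ L S) : (S.card : ℝ) ≤ (2 * max L 0 / δ + 1) ^ 3 := by
  have h := Literature.MathematicalPhysics.StatisticalMechanics.card_le_of_separated_of_dist_le
    S 0 hδ (le_max_right L 0)
    (fun c hc => by rw [dist_zero_right]; exact (hS.1 c hc).2.trans (le_max_left _ _))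
    (fun c hc d hd hcd => by rw [dist_eq_norm]; exact hS.2 c hc d hd hcd)
  simpa [finrank_euclideanSpace_fin] using h

/-- **Strong LP duality at finite level for means.**  If every lens-consistent mean at level
`(δ, r, L)` is nonnegative at a functional `a` bounded on the `(δ, L)`-admissible rooted patterns,
then for every `η > 0` a bounded transfer rule `g` achieves `a + T_g ≥ −η` on every admissible
pattern (Hahn–Banach, via `stub_abstractMeanDuality`). [folklore] -/
theorem stub_meanDuality :
    ∀ (δ r L : ℝ), 0 < δ → ∀ a : Finset (EuclideanSpace ℝ (Fin 3)) → ℝ, (∃ M : ℝ, ∀ S : Finset (EuclideanSpace ℝ (Fin 3)), Literature.Probability.PointProcesses.IsRootedPattern δ L S → |a S| ≤ M) →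
      (∀ m : (Finset (EuclideanSpace ℝ (Fin 3)) → ℝ) → ℝ,
        (∀ f₁ f₂ : Finset (EuclideanSpace ℝ (Fin 3)) → ℝ, m (f₁ + f₂) = m f₁ + m f₂) →
        (∀ (t : ℝ) (f : Finset (EuclideanSpace ℝ (Fin 3)) → ℝ), m (t • f) = t * m f) →
        (∀ f : Finset (EuclideanSpace ℝ (Fin 3)) → ℝ, (∀ S : Finset (EuclideanSpace ℝ (Fin 3)), Literature.Probability.PointProcesses.IsRootedPattern δ L S → 0 ≤ f S ∧ f S ≤ 1) → 0 ≤ m f) →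
        m (fun _ => 1) = 1 →
        (∀ g : EuclideanSpace ℝ (Fin 3) → Finset (EuclideanSpace ℝ (Fin 3)) → Finset (EuclideanSpace ℝ (Fin 3)) → ℝ, (∃ M : ℝ, ∀ v p q, |g v p q| ≤ M) →
          m (fun S => ∑ v ∈ Literature.Probability.PointProcesses.lens r L S, (g v (Literature.Probability.PointProcesses.ballPattern r S) (Literature.Probability.PointProcesses.ballPattern r (Literature.Probability.PointProcesses.reroot S v)) - g (-v) (Literature.Probability.PointProcesses.ballPattern r (Literature.Probability.PointProcesses.reroot S v)) (Literature.Probability.PointProcesses.ballPattern r S))) = 0) →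
        0 ≤ m a) →
      ∀ η : ℝ, 0 < η → ∃ g : EuclideanSpace ℝ (Fin 3) → Finset (EuclideanSpace ℝ (Fin 3)) → Finset (EuclideanSpace ℝ (Fin 3)) → ℝ, (∃ M : ℝ, ∀ v p q, |g v p q| ≤ M) ∧
        ∀ S : Finset (EuclideanSpace ℝ (Fin 3)), Literature.Probability.PointProcesses.IsRootedPattern δ L S →
          -η ≤ a S + ∑ v ∈ Literature.Probability.PointProcesses.lens r L S, (g v (Literature.Probability.PointProcesses.ballPattern r S) (Literature.Probability.PointProcesses.ballPattern r (Literature.Probability.PointProcesses.reroot S v)) - g (-v) (Literature.Probability.PointProcesses.ballPattern r (Literature.Probability.PointProcesses.reroot S v)) (Literature.Probability.PointProcesses.ballPattern r S)) := by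
  intro δ r L hδ a ha hmean η hη
  -- the admissible patterns, the transports and the cone they form
  let Ω : Set (Finset (EuclideanSpace ℝ (Fin 3))) := {S | IsRootedPattern δ L S}
  let T : (EuclideanSpace ℝ (Fin 3) → Finset (EuclideanSpace ℝ (Fin 3)) →
      Finset (EuclideanSpace ℝ (Fin 3)) → ℝ) → Finset (EuclideanSpace ℝ (Fin 3)) → ℝ :=
    fun g S => ∑ v ∈ lens r L S, (g v (ballPattern r S) (ballPattern r (reroot S v)) -
      g (-v) (ballPattern r (reroot S v)) (ballPattern r S))
  let K : Set (Finset (EuclideanSpace ℝ (Fin 3)) → ℝ) :=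
    {k | ∃ g, (∃ M : ℝ, ∀ v p q, |g v p q| ≤ M) ∧ k = T g}
  have hT_add : ∀ g₁ g₂, T (g₁ + g₂) = T g₁ + T g₂ := fun g₁ g₂ => by
    funext S
    simp only [T, Pi.add_apply, ← Finset.sum_add_distrib]
    exact Finset.sum_congr rfl fun v _ => by ring
  have hT_smul : ∀ (t : ℝ) (g), T (t • g) = t • T g := fun t g => by
    funext S
    simp only [T, Pi.smul_apply, smul_eq_mul, Finset.mul_sum]
    exact Finset.sum_congr rfl fun v _ => by ring
  have hKadd : ∀ k₁ ∈ K, ∀ k₂ ∈ K, k₁ + k₂ ∈ K := by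
    rintro k₁ ⟨g₁, ⟨M₁, hM₁⟩, rfl⟩ k₂ ⟨g₂, ⟨M₂, hM₂⟩, rfl⟩
    refine ⟨g₁ + g₂, ⟨M₁ + M₂, fun v p q => ?_⟩, (hT_add g₁ g₂).symm⟩
    simp only [Pi.add_apply]
    exact (abs_add_le _ _).trans (add_le_add (hM₁ v p q) (hM₂ v p q))
  have hKsmul : ∀ (t : ℝ), ∀ k ∈ K, t • k ∈ K := by
    rintro t k ⟨g, ⟨M, hM⟩, rfl⟩
    refine ⟨t • g, ⟨|t| * M, fun v p q => ?_⟩, (hT_smul t g).symm⟩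
    simp only [Pi.smul_apply, smul_eq_mul, abs_mul]
    exact mul_le_mul_of_nonneg_left (hM v p q) (abs_nonneg t)
  have hK0 : (0 : Finset (EuclideanSpace ℝ (Fin 3)) → ℝ) ∈ K :=
    ⟨0, ⟨0, fun v p q => by simp⟩, by funext S; simp [T]⟩
  have ha' : ∃ M : ℝ, ∀ S ∈ Ω, |a S| ≤ M := ha
  have hKb : ∀ k ∈ K, ∃ M : ℝ, ∀ S ∈ Ω, |k S| ≤ M := by
    rintro k ⟨g, ⟨M, hM⟩, rfl⟩
    refine ⟨(2 * max L 0 / δ + 1) ^ 3 * (2 * M), fun S hS => ?_⟩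
    have hM0 : 0 ≤ M := (abs_nonneg _).trans (hM 0 ∅ ∅)
    calc |T g S| ≤ ∑ v ∈ lens r L S, |g v (ballPattern r S) (ballPattern r (reroot S v)) -
          g (-v) (ballPattern r (reroot S v)) (ballPattern r S)| := Finset.abs_sum_le_sum_abs _ _
      _ ≤ ∑ _v ∈ lens r L S, 2 * M := Finset.sum_le_sum fun v _ => (abs_sub _ _).trans (by
          linarith [hM v (ballPattern r S) (ballPattern r (reroot S v)),
            hM (-v) (ballPattern r (reroot S v)) (ballPattern r S)])
      _ = (lens r L S).card * (2 * M) := by rw [Finset.sum_const, nsmul_eq_mul]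
      _ ≤ S.card * (2 * M) :=
          mul_le_mul_of_nonneg_right (Nat.cast_le.2 (Finset.card_le_card
            fun v hv => (Finset.mem_filter.1 hv).1)) (by linarith)
      _ ≤ (2 * max L 0 / δ + 1) ^ 3 * (2 * M) :=
          mul_le_mul_of_nonneg_right (meanDuality_card_le hδ hS) (by linarith)
  have hKpos : ∀ k ∈ K, ∀ t : ℝ, t < 0 → ∃ S ∈ Ω, t < k S := by
    rintro k ⟨g, -, rfl⟩ t ht
    refine ⟨∅, Literature.Probability.PointProcesses.isRootedPattern_empty δ L, ?_⟩
    simpa [T] using ht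
  obtain ⟨m, hm_add, hm_smul, hm_pos, hm_one, hm_K, hm_val⟩ :=
    stub_abstractMeanDuality (Finset (EuclideanSpace ℝ (Fin 3))) Ω K a hKadd hKsmul hK0 ha' hKb
      hKpos
  have hma : 0 ≤ m a :=
    hmean m hm_add hm_smul (fun f hf => hm_pos f fun S hS => hf S hS) hm_one
      (fun g hg => hm_K _ ⟨g, hg, rfl⟩)
  by_contra hcon
  push Not at hcon
  have hle : m a ≤ -η := hm_val (-η) fun k hk => by
    obtain ⟨g, hg, rfl⟩ := hk
    obtain ⟨S, hS, hlt⟩ := hcon g hg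
    exact ⟨S, hS, hlt⟩
  linarith

end Summit.AtomisticToContinuum.Crystallization.Theorems.PatternPricedCertificates

end
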